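/-
Copyright (c) 2026. All rights reserved.
Released under Apache 2.0 license as described in the file LICENSE.
Authors: abc-iut cell — seat abc-iut-f-100 (F fact-proving wave, tranche 100; FACT-LIST row F-0128).
Proof-only companion to `HolomorphicCores.lean` ([AbsTopIII] Prop 2.5 (a)); no new definitions.
-/
import Literature.AnabelianGeometry.AbsoluteAnabelian.ParallelogramsRelationsClosureRefuted
import HarnessLib

/-!
# [AbsTopIII] Prop 2.5 (a): `StrictlyCollinear` is a RELATION — structure, model instances and
# non-instances, universal closure REFUTED (FACT-LIST F-0128; proof-only)

S. Mochizuki, *Topics in absolute anabelian geometry III: global reconstruction algorithms*, J. Math. Sci.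
Univ. Tokyo 22 (2015) [MochizukiAbsTopIII2015], Prop. 2.5, kurims manuscript p. 56:

> (a) […] Define two strict line segments to be *strictly collinear* if their intersection is of infinite
> cardinality. Define a *strict chain* of `U` to be a finite ordered set of strict line segments
> `L₁, …, Lₙ` [where `n ≥ 2` is an integer] such that `Lᵢ, Lᵢ₊₁` are strictly collinear for
> `i = 1, …, n − 1`. Then one constructs the [closed, bounded] *line segments* of `U` by observing that
> a line segment may be characterized as the union of strict line segments contained [in] a strict chain

The abc-iut cell's FACT-LIST row **F-0128** `Parallelograms.StrictlyCollinear` (`HolomorphicCores.lean`,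
abc-iut-L4-t14) names one of the RELATIONS produced by the algorithm of Prop. 2.5 on an abstract pair
`(U, 𝒬)` — vocabulary (a parametrised predicate, binders `L₁ L₂ : Set U`), like its siblings `Parallel` /
`StrictlyCoOriented` / `LocalAdd` (F-0125…F-0127, settled in `ParallelogramsRelationsClosureRefuted.lean`,
abc-iut-f-099) and `StrictlyParallel` (F-0129, `HolomorphicCoresStrictlyParallel.lean`).  A relation has no
truth value "as a fact"; this file records the kernel events that classify the row (cell rule R5:
admissible AT NAMED INSTANCES only):

* STRUCTURE on abstract data (any `U`, `𝒬`): strict collinearity is symmetric, monotone, reflexive on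
  strict line segments, and forces both sets to be infinite and to meet; two strictly collinear strict line
  segments form a strict chain (`n = 2`), so their union IS a line segment
  (`StrictlyCollinear.isLineSegment_union` — the printed construction of (a)); in particular a strict line
  segment is a line segment (`IsStrictLineSegment.isLineSegment`).
* THE PRINTED INPUT DATA `U ⊆ ℂ` open, any `𝒮(U) ⊆ 𝒬 ⊆ 𝒫(U)`: for strict line segments (non-degenerate
  closed segments, `IsStrictLineSegment.exists_eq_segment_of_subset`, abc-iut-L6-t15) strict collinearity
  is "two common points" (`strictlyCollinear_iff_nontrivial`) and the union is again a non-degenerate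
  closed segment (`StrictlyCollinear.exists_image_union_eq_segment`); nested segments `[a, c] ⊆ [a, b]`
  are strictly collinear (`strictlyCollinear_of_mem_segment`), perpendicular edges `[z, z + v]`,
  `[z, z + i v]` are NOT (`not_strictlyCollinear_perpendicular`) — and they ARE strict line segments as soon
  as the four flanking squares fit into `U` (`isStrictLineSegment_and_not_strictlyCollinear`).
* UNIVERSAL CLOSURE REFUTED, witnessed at the printed model `(ℂ, 𝒮(ℂ))` by genuine strict line segments,
  not at a junk instance: `not_forall_strictLineSegments_strictlyCollinear` (the unit edges `[0, 1]`,
  `[0, i]` are strict line segments of `(ℂ, 𝒮(ℂ))` meeting in one point), hence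
  `not_forall_strictlyCollinear`.

So the row carries the FACT-LIST label «universal-closure REFUTED; instance forms PROVED» and may be bound
by a consumer only through the named instance theorems.  Refereed pre-IUT material, elementary plane
geometry; a refuted closure says the row is a relation on data, not that anything in print is false;
nothing here bears on the disputed [IUTchIII] Cor. 3.12 or takes a side.
-/

namespace Literature.AnabelianGeometry.AbsoluteAnabelian

open _root_.Complex _root_.Set

noncomputable section

namespace Parallelograms

/-! ### Structure of the relation on abstract data `(U, 𝒬)` -/

section Abstract

variable {U : Type*} {𝒬 : Set (Set U)}

/-- Strict collinearity is symmetric. [cite: MochizukiAbsTopIII2015, Proposition 2.5 (a) p.56] -/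
theorem StrictlyCollinear.symm {L₁ L₂ : Set U} (h : StrictlyCollinear L₁ L₂) : StrictlyCollinear L₂ L₁ := by
  unfold StrictlyCollinear at h ⊢
  rwa [inter_comm]

/-- Strict collinearity is symmetric (iff form). [cite: MochizukiAbsTopIII2015, Proposition 2.5 (a) p.56] -/
theorem strictlyCollinear_comm {L₁ L₂ : Set U} : StrictlyCollinear L₁ L₂ ↔ StrictlyCollinear L₂ L₁ :=
  ⟨StrictlyCollinear.symm, StrictlyCollinear.symm⟩

/-- Strict collinearity is monotone in both arguments (an infinite intersection stays infinite in larger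
sets). [cite: MochizukiAbsTopIII2015, Proposition 2.5 (a) p.56] -/
theorem StrictlyCollinear.mono {L₁ L₂ M₁ M₂ : Set U} (h : StrictlyCollinear L₁ L₂) (h₁ : L₁ ⊆ M₁)
    (h₂ : L₂ ⊆ M₂) : StrictlyCollinear M₁ M₂ :=
  Set.Infinite.mono (inter_subset_inter h₁ h₂) h

/-- Strictly collinear sets are infinite (left). [cite: MochizukiAbsTopIII2015, Proposition 2.5 (a) p.56] -/
theorem StrictlyCollinear.infinite_left {L₁ L₂ : Set U} (h : StrictlyCollinear L₁ L₂) : L₁.Infinite :=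
  Set.Infinite.mono inter_subset_left h

/-- Strictly collinear sets are infinite (right). [cite: MochizukiAbsTopIII2015, Proposition 2.5 (a) p.56] -/
theorem StrictlyCollinear.infinite_right {L₁ L₂ : Set U} (h : StrictlyCollinear L₁ L₂) : L₂.Infinite :=
  Set.Infinite.mono inter_subset_right h

/-- Strictly collinear sets meet. [cite: MochizukiAbsTopIII2015, Proposition 2.5 (a) p.56] -/
theorem StrictlyCollinear.inter_nonempty {L₁ L₂ : Set U} (h : StrictlyCollinear L₁ L₂) :
    (L₁ ∩ L₂).Nonempty :=
  Set.Infinite.nonempty h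

/-- **F-0128, a non-instance on any data:** nothing is strictly collinear with the empty set.
[cite: MochizukiAbsTopIII2015, Proposition 2.5 (a) p.56] -/
theorem not_strictlyCollinear_empty_left (L : Set U) : ¬ StrictlyCollinear (∅ : Set U) L := by
  simp [StrictlyCollinear]

/-- **F-0128, a non-instance on any data:** sets with finite intersection are not strictly collinear.
[cite: MochizukiAbsTopIII2015, Proposition 2.5 (a) p.56] -/
theorem not_strictlyCollinear_of_finite_inter {L₁ L₂ : Set U} (h : (L₁ ∩ L₂).Finite) :
    ¬ StrictlyCollinear L₁ L₂ :=
  fun h' => h' h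

/-- A strict line segment is infinite (by definition). [cite: MochizukiAbsTopIII2015, Proposition 2.5 (a) p.56] -/
theorem IsStrictLineSegment.infinite {L : Set U} (hL : IsStrictLineSegment 𝒬 L) : L.Infinite := by
  obtain ⟨_, -, _, -, -, -, hinf⟩ := hL
  exact hinf

/-- **F-0128, instance on any data:** every strict line segment is strictly collinear with itself.
[cite: MochizukiAbsTopIII2015, Proposition 2.5 (a) p.56] -/
theorem IsStrictLineSegment.strictlyCollinear_self {L : Set U} (hL : IsStrictLineSegment 𝒬 L) :
    StrictlyCollinear L L := by
  unfold StrictlyCollinear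
  rw [inter_self]
  exact hL.infinite

/-- Two strictly collinear strict line segments form a strict chain `L₁, L₂` (`n = 2`).
[cite: MochizukiAbsTopIII2015, Proposition 2.5 (a) p.56] -/
theorem StrictlyCollinear.isStrictChain_pair {L₁ L₂ : Set U} (h₁ : IsStrictLineSegment 𝒬 L₁)
    (h₂ : IsStrictLineSegment 𝒬 L₂) (h : StrictlyCollinear L₁ L₂) : IsStrictChain 𝒬 [L₁, L₂] := by
  refine ⟨by simp, fun L hL => ?_, List.isChain_pair.2 h⟩
  simp only [List.mem_cons, List.not_mem_nil, or_false] at hL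
  rcases hL with rfl | rfl
  · exact h₁
  · exact h₂

/-- **F-0128, the printed use of the relation (Prop 2.5 (a)): the union of two strictly collinear strict
line segments is a LINE SEGMENT** ("the union of strict line segments contained [in] a strict chain").
[cite: MochizukiAbsTopIII2015, Proposition 2.5 (a) p.56] -/
theorem StrictlyCollinear.isLineSegment_union {L₁ L₂ : Set U} (h₁ : IsStrictLineSegment 𝒬 L₁)
    (h₂ : IsStrictLineSegment 𝒬 L₂) (h : StrictlyCollinear L₁ L₂) : IsLineSegment 𝒬 (L₁ ∪ L₂) :=
  ⟨[L₁, L₂], h.isStrictChain_pair h₁ h₂, by simp⟩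

/-- A strict line segment is a line segment (the strict chain `L, L`).
[cite: MochizukiAbsTopIII2015, Proposition 2.5 (a) p.56] -/
theorem IsStrictLineSegment.isLineSegment {L : Set U} (hL : IsStrictLineSegment 𝒬 L) : IsLineSegment 𝒬 L := by
  simpa using hL.strictlyCollinear_self.isLineSegment_union hL hL

end Abstract

/-! ### The printed input data: `U ⊆ ℂ` open, `𝒮(U) ⊆ 𝒬 ⊆ 𝒫(U)` -/

section Planar

variable {U : Set ℂ} (hU : IsOpen U) {𝒬 : Set (Set U)}
  (h𝒬 : ∀ Q ∈ 𝒬, Subtype.val '' Q ∈ parallelogramsIn U)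
  (h𝒮 : ∀ Q : Set U, Subtype.val '' Q ∈ squaresIn U → Q ∈ 𝒬)

include hU h𝒬 h𝒮 in
/-- **F-0128 at the printed input data: strict collinearity = two common points.** For strict line
segments `L₁, L₂` of `(U, 𝒬)` (non-degenerate closed segments, `IsStrictLineSegment.exists_eq_segment_of_subset`)
the intersection is infinite iff it contains two distinct points (it is convex).
[cite: MochizukiAbsTopIII2015, Proposition 2.5 (a) p.56] -/
theorem strictlyCollinear_iff_nontrivial {L₁ L₂ : Set U} (h₁ : IsStrictLineSegment 𝒬 L₁)
    (h₂ : IsStrictLineSegment 𝒬 L₂) : StrictlyCollinear L₁ L₂ ↔ (L₁ ∩ L₂).Nontrivial := by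
  refine ⟨Set.Infinite.nontrivial, fun hnt => ?_⟩
  obtain ⟨a, b, -, h₁e⟩ := h₁.exists_eq_segment_of_subset hU h𝒬 h𝒮
  obtain ⟨c, d, -, h₂e⟩ := h₂.exists_eq_segment_of_subset hU h𝒬 h𝒮
  obtain ⟨x, hx, y, hy, hxy⟩ := hnt
  have hconv : Convex ℝ (segment ℝ a b ∩ segment ℝ c d) := (convex_segment _ _).inter (convex_segment _ _)
  have hxS : (x : ℂ) ∈ segment ℝ a b ∩ segment ℝ c d :=
    ⟨h₁e ▸ mem_image_of_mem _ hx.1, h₂e ▸ mem_image_of_mem _ hx.2⟩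
  have hyS : (y : ℂ) ∈ segment ℝ a b ∩ segment ℝ c d :=
    ⟨h₁e ▸ mem_image_of_mem _ hy.1, h₂e ▸ mem_image_of_mem _ hy.2⟩
  have hsub : segment ℝ (x : ℂ) y ⊆ segment ℝ a b ∩ segment ℝ c d := hconv.segment_subset hxS hyS
  have hinf : (Subtype.val '' (L₁ ∩ L₂)).Infinite := by
    rw [image_inter Subtype.val_injective, h₁e, h₂e]
    exact (segment_infinite fun h => hxy (Subtype.ext h)).mono hsub
  exact Set.Infinite.of_image _ hinf

include hU h𝒬 h𝒮 in
/-- **F-0128 at the printed input data:** the union of two strictly collinear strict line segments of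
`(U, 𝒬)` is (the trace of) a non-degenerate closed segment — they are collinear and overlap.
[cite: MochizukiAbsTopIII2015, Proposition 2.5 (a) p.56] -/
theorem StrictlyCollinear.exists_image_union_eq_segment {L₁ L₂ : Set U} (h₁ : IsStrictLineSegment 𝒬 L₁)
    (h₂ : IsStrictLineSegment 𝒬 L₂) (h : StrictlyCollinear L₁ L₂) :
    ∃ a b : ℂ, a ≠ b ∧ Subtype.val '' (L₁ ∪ L₂) = segment ℝ a b := by
  obtain ⟨a, b, hab, h₁e⟩ := h₁.exists_eq_segment_of_subset hU h𝒬 h𝒮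
  obtain ⟨c, d, hcd, h₂e⟩ := h₂.exists_eq_segment_of_subset hU h𝒬 h𝒮
  have hinf : (segment ℝ a b ∩ segment ℝ c d).Infinite := by
    rw [← h₁e, ← h₂e, ← image_inter Subtype.val_injective]
    exact h.image Subtype.val_injective.injOn
  obtain ⟨e, f, hef, hU'⟩ := exists_eq_segment_union hab hcd hinf
  exact ⟨e, f, hef, by rw [image_union, h₁e, h₂e, hU']⟩

/-- **F-0128, instance at the printed input data:** nested non-degenerate segments are strictly collinear —
for `[a, b] ⊆ U` and `c ∈ [a, b]`, `c ≠ a`, the traces of `[a, b]` and `[a, c]` have infinite intersection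
`[a, c]`. [cite: MochizukiAbsTopIII2015, Proposition 2.5 (a) p.56] -/
theorem strictlyCollinear_of_mem_segment {a b c : ℂ} (hab : segment ℝ a b ⊆ U) (hc : c ∈ segment ℝ a b)
    (hca : c ≠ a) :
    StrictlyCollinear (Subtype.val ⁻¹' segment ℝ a b : Set U) (Subtype.val ⁻¹' segment ℝ a c) := by
  have hsub : segment ℝ a c ⊆ segment ℝ a b := (convex_segment a b).segment_subset (left_mem_segment ℝ a b) hc
  unfold StrictlyCollinear
  rw [← preimage_inter, inter_eq_right.2 hsub]
  exact preimage_val_infinite (hsub.trans hab) (segment_infinite hca.symm)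

/-- **F-0128, non-instance at the printed input data:** two PERPENDICULAR edges `[z, z + v]`, `[z, z + i v]`
(`v ≠ 0`) are not strictly collinear — they meet in the single point `z`.
[cite: MochizukiAbsTopIII2015, Proposition 2.5 (a) p.56] -/
theorem not_strictlyCollinear_perpendicular {z v : ℂ} (hv : v ≠ 0) :
    ¬ StrictlyCollinear (Subtype.val ⁻¹' segment ℝ z (z + v) : Set U)
      (Subtype.val ⁻¹' segment ℝ z (z + I * v)) := by
  apply not_strictlyCollinear_of_finite_inter
  rw [← preimage_inter, segment_inter_segment_eq_of_linearIndependent (linearIndependent_pair_mul_I hv)]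
  exact (finite_singleton z).preimage Subtype.val_injective.injOn

include hU h𝒬 h𝒮 in
/-- **F-0128, non-instances exist among STRICT line segments of the printed data:** if the squares with
edge `v ≠ 0` above and below `[z, z + v]` and to the left and right of `[z, z + i v]` have closures in `U`,
then `[z, z + v]` and `[z, z + i v]` are STRICT line segments of `(U, 𝒬)` that are NOT strictly collinear
(they meet in the single point `z`). [cite: MochizukiAbsTopIII2015, Proposition 2.5 (a) p.56] -/
theorem isStrictLineSegment_and_not_strictlyCollinear {z v : ℂ} (hv : v ≠ 0)
    (h₁ : closure (openParallelogram z v (I * v)) ⊆ U)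
    (h₂ : closure (openParallelogram (z - I * v) v (I * v)) ⊆ U)
    (h₃ : closure (openParallelogram z (I * v) (-v)) ⊆ U)
    (h₄ : closure (openParallelogram (z + v) (I * v) (-v)) ⊆ U) :
    IsStrictLineSegment 𝒬 (Subtype.val ⁻¹' segment ℝ z (z + v)) ∧
      IsStrictLineSegment 𝒬 (Subtype.val ⁻¹' segment ℝ z (z + I * v)) ∧
      ¬ StrictlyCollinear (Subtype.val ⁻¹' segment ℝ z (z + v) : Set U)
        (Subtype.val ⁻¹' segment ℝ z (z + I * v)) := by
  have hIIv : I * (I * v) = -v := by rw [← mul_assoc, I_mul_I, neg_one_mul]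
  have hz : z - I * (I * v) = z + v := by rw [hIIv, sub_neg_eq_add]
  refine ⟨isStrictLineSegment_of_squares_subset hU h𝒬 h𝒮 hv h₁ h₂,
    isStrictLineSegment_of_squares_subset hU h𝒬 h𝒮 (mul_ne_zero I_ne_zero hv) (by rwa [hIIv])
      (by rwa [hz, hIIv]),
    not_strictlyCollinear_perpendicular hv⟩

end Planar

/-! ### The universal closure of the row is false (witnessed at the model `(ℂ, 𝒮(ℂ))`) -/

section Closure

/-- **F-0128: the universal closure of `Parallelograms.StrictlyCollinear` is FALSE — even restricted to
STRICT LINE SEGMENTS of the printed input data**: at `(ℂ, 𝒮(ℂ))` the perpendicular unit edges `[0, 1]`,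
`[0, i]` are strict line segments (each flanked by two unit squares) meeting in the single point `0`.  The
row is a relation (Prop 2.5 (a)), admissible at named instances only; positive instances:
`IsStrictLineSegment.strictlyCollinear_self`, `strictlyCollinear_of_mem_segment`, and the printed use
`StrictlyCollinear.isLineSegment_union`. [cite: MochizukiAbsTopIII2015, Proposition 2.5 (a) p.56] -/
theorem not_forall_strictLineSegments_strictlyCollinear :
    ¬ ∀ (U : Type) (𝒬 : Set (Set U)) (L₁ L₂ : Set U),
        Literature.AnabelianGeometry.AbsoluteAnabelian.Parallelograms.IsStrictLineSegment 𝒬 L₁ →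
        Literature.AnabelianGeometry.AbsoluteAnabelian.Parallelograms.IsStrictLineSegment 𝒬 L₂ →
        Literature.AnabelianGeometry.AbsoluteAnabelian.Parallelograms.StrictlyCollinear L₁ L₂ := by
  intro h
  obtain ⟨h₁, h₂, hne⟩ := isStrictLineSegment_and_not_strictlyCollinear (U := (univ : Set ℂ))
    isOpen_univ squares_hyps.1 squares_hyps.2 (z := 0) (v := 1) one_ne_zero (subset_univ _)
    (subset_univ _) (subset_univ _) (subset_univ _)
  exact hne (h _ _ _ _ h₁ h₂)

/-- **F-0128: the universal closure of `Parallelograms.StrictlyCollinear` is FALSE** (corollary; the bare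
closure quantifies over arbitrary subsets, e.g. the empty one).
[cite: MochizukiAbsTopIII2015, Proposition 2.5 (a) p.56] -/
theorem not_forall_strictlyCollinear :
    ¬ ∀ (U : Type) (L₁ L₂ : Set U),
        Literature.AnabelianGeometry.AbsoluteAnabelian.Parallelograms.StrictlyCollinear L₁ L₂ :=
  fun h => not_forall_strictLineSegments_strictlyCollinear fun U _ L₁ L₂ _ _ => h U L₁ L₂

end Closure

/-! ### Strict collinearity is not transitive (witnessed at the model `(ℂ, 𝒮(ℂ))`)

Print builds the line segments of `U` from strict CHAINS `L₁, …, Lₙ` (consecutive members strictly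
collinear, `IsStrictChain`), not from equivalence classes: strict collinearity is reflexive on strict line
segments (`IsStrictLineSegment.strictlyCollinear_self`) and symmetric (`StrictlyCollinear.symm`) but NOT
transitive — already among genuine strict line segments of the printed model.  (The abstract-data version
of this remark, on `ℕ` with evens ~ `univ` ~ odds, was observed by seat abc-iut-w5-d115 in its audit probe
of this file; the theorems below give it at the printed input data.) -/

section Transitivity

/-- Auxiliary computation rule: an explicit convex combination `a x + b y` (`a, b ≥ 0`, `a + b = 1`)
lies on the closed segment `[x, y]` of `ℂ`. [cite: MochizukiAbsTopIII2015, Proposition 2.5 (a) p.56] -/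
private theorem mem_segment_of_combo {x y p : ℂ} (a b : ℝ) (ha : 0 ≤ a) (hb : 0 ≤ b) (hab : a + b = 1)
    (h : (a : ℂ) * x + (b : ℂ) * y = p) : p ∈ segment ℝ x y :=
  ⟨a, b, ha, hb, hab, by rwa [Complex.real_smul, Complex.real_smul]⟩

/-- **F-0128, strict collinearity is NOT TRANSITIVE at the printed input data**: at the model `(ℂ, 𝒮(ℂ))`
the three collinear edges `L₁ = [0, 2]`, `L₂ = [1, 4]`, `L₃ = [3, 6]` are STRICT line segments (each
flanked by two squares), `L₁, L₂` are strictly collinear (`L₁ ∩ L₂ = [1, 2]`), `L₂, L₃` are strictly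
collinear (`L₂ ∩ L₃ = [3, 4]`), but `L₁, L₃` are not (`L₁ ∩ L₃ = ∅`).  So `L₁, L₂, L₃` is a strict chain
(`n = 3`) whose end members are not strictly collinear — the reason Prop 2.5 (a) characterizes a line
segment as "the union of strict line segments contained [in] a strict chain" rather than via an
equivalence relation. [cite: MochizukiAbsTopIII2015, Proposition 2.5 (a) p.56] -/
theorem exists_strictLineSegments_strictlyCollinear_not_trans :
    ∃ L₁ L₂ L₃ : Set (univ : Set ℂ),
      IsStrictLineSegment {Q : Set (univ : Set ℂ) | Subtype.val '' Q ∈ squaresIn univ} L₁ ∧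
      IsStrictLineSegment {Q : Set (univ : Set ℂ) | Subtype.val '' Q ∈ squaresIn univ} L₂ ∧
      IsStrictLineSegment {Q : Set (univ : Set ℂ) | Subtype.val '' Q ∈ squaresIn univ} L₃ ∧
      StrictlyCollinear L₁ L₂ ∧ StrictlyCollinear L₂ L₃ ∧ ¬ StrictlyCollinear L₁ L₃ := by
  have hU : IsOpen (univ : Set ℂ) := isOpen_univ
  have h𝒬 := squares_hyps.1
  have h𝒮 := squares_hyps.2
  have h2 : (2 : ℂ) ≠ 0 := two_ne_zero
  have h3 : (3 : ℂ) ≠ 0 := three_ne_zero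
  have hs₁ : IsStrictLineSegment {Q : Set (univ : Set ℂ) | Subtype.val '' Q ∈ squaresIn univ}
      (Subtype.val ⁻¹' segment ℝ (0 : ℂ) (0 + 2)) :=
    isStrictLineSegment_of_squares_subset hU h𝒬 h𝒮 h2 (subset_univ _) (subset_univ _)
  have hs₂ : IsStrictLineSegment {Q : Set (univ : Set ℂ) | Subtype.val '' Q ∈ squaresIn univ}
      (Subtype.val ⁻¹' segment ℝ (1 : ℂ) (1 + 3)) :=
    isStrictLineSegment_of_squares_subset hU h𝒬 h𝒮 h3 (subset_univ _) (subset_univ _)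
  have hs₃ : IsStrictLineSegment {Q : Set (univ : Set ℂ) | Subtype.val '' Q ∈ squaresIn univ}
      (Subtype.val ⁻¹' segment ℝ (3 : ℂ) (3 + 3)) :=
    isStrictLineSegment_of_squares_subset hU h𝒬 h𝒮 h3 (subset_univ _) (subset_univ _)
  refine ⟨_, _, _, hs₁, hs₂, hs₃, ?_, ?_, ?_⟩
  · -- `1` and `2` are two distinct common points of `[0, 2]` and `[1, 4]`
    rw [strictlyCollinear_iff_nontrivial hU h𝒬 h𝒮 hs₁ hs₂]
    refine ⟨⟨1, mem_univ _⟩, ⟨?_, ?_⟩, ⟨2, mem_univ _⟩, ⟨?_, ?_⟩, fun h => ?_⟩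
    · exact mem_segment_of_combo (1 / 2) (1 / 2) (by norm_num) (by norm_num) (by norm_num)
        (by push_cast; ring)
    · exact left_mem_segment ℝ _ _
    · exact mem_segment_of_combo 0 1 le_rfl zero_le_one (by norm_num) (by push_cast; ring)
    · exact mem_segment_of_combo (2 / 3) (1 / 3) (by norm_num) (by norm_num) (by norm_num)
        (by push_cast; ring)
    · have h' : (1 : ℂ) = 2 := congrArg Subtype.val h
      norm_num at h'
  · -- `3` and `4` are two distinct common points of `[1, 4]` and `[3, 6]`
    rw [strictlyCollinear_iff_nontrivial hU h𝒬 h𝒮 hs₂ hs₃]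
    refine ⟨⟨3, mem_univ _⟩, ⟨?_, ?_⟩, ⟨4, mem_univ _⟩, ⟨?_, ?_⟩, fun h => ?_⟩
    · exact mem_segment_of_combo (1 / 3) (2 / 3) (by norm_num) (by norm_num) (by norm_num)
        (by push_cast; ring)
    · exact left_mem_segment ℝ _ _
    · exact mem_segment_of_combo 0 1 le_rfl zero_le_one (by norm_num) (by push_cast; ring)
    · exact mem_segment_of_combo (2 / 3) (1 / 3) (by norm_num) (by norm_num) (by norm_num)
        (by push_cast; ring)
    · have h' : (3 : ℂ) = 4 := congrArg Subtype.val h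
      norm_num at h'
  · -- `[0, 2]` and `[3, 6]` are disjoint: real parts `≤ 2` versus `≥ 3`
    apply not_strictlyCollinear_of_finite_inter
    rw [← preimage_inter]
    suffices he : segment ℝ (0 : ℂ) (0 + 2) ∩ segment ℝ (3 : ℂ) (3 + 3) = ∅ by
      rw [he, preimage_empty]; exact finite_empty
    refine eq_empty_of_forall_notMem fun p ⟨hp₁, hp₂⟩ => ?_
    obtain ⟨a, b, ha, hb, hab, rfl⟩ := hp₁
    obtain ⟨c, d, hc, hd, hcd, he⟩ := hp₂
    have hre := congrArg Complex.re he
    simp only [Complex.add_re, Complex.smul_re, Complex.zero_re, smul_eq_mul] at hre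
    norm_num at hre
    linarith

/-- **F-0128: strict collinearity of STRICT LINE SEGMENTS is not a transitive relation** (universal
closure of transitivity REFUTED at the printed model `(ℂ, 𝒮(ℂ))` by
`exists_strictLineSegments_strictlyCollinear_not_trans`): this is why Prop 2.5 (a) works with strict
chains. [cite: MochizukiAbsTopIII2015, Proposition 2.5 (a) p.56] -/
theorem not_forall_strictLineSegments_strictlyCollinear_trans :
    ¬ ∀ (U : Type) (𝒬 : Set (Set U)) (L₁ L₂ L₃ : Set U),
        Literature.AnabelianGeometry.AbsoluteAnabelian.Parallelograms.IsStrictLineSegment 𝒬 L₁ →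
        Literature.AnabelianGeometry.AbsoluteAnabelian.Parallelograms.IsStrictLineSegment 𝒬 L₂ →
        Literature.AnabelianGeometry.AbsoluteAnabelian.Parallelograms.IsStrictLineSegment 𝒬 L₃ →
        Literature.AnabelianGeometry.AbsoluteAnabelian.Parallelograms.StrictlyCollinear L₁ L₂ →
        Literature.AnabelianGeometry.AbsoluteAnabelian.Parallelograms.StrictlyCollinear L₂ L₃ →
        Literature.AnabelianGeometry.AbsoluteAnabelian.Parallelograms.StrictlyCollinear L₁ L₃ := by
  intro h
  obtain ⟨L₁, L₂, L₃, h₁, h₂, h₃, h₁₂, h₂₃, h₁₃⟩ := exists_strictLineSegments_strictlyCollinear_not_trans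
  exact h₁₃ (h _ _ L₁ L₂ L₃ h₁ h₂ h₃ h₁₂ h₂₃)

/-- **F-0128, the printed remedy: the same three edges DO form a strict chain** (`n = 3`; consecutive
members strictly collinear), so their union `[0, 6]` is a line segment of `(ℂ, 𝒮(ℂ))` in the sense of
Prop 2.5 (a) (`IsLineSegment` = union of a strict chain) although its end members `[0, 2]`, `[3, 6]` are
not strictly collinear. [cite: MochizukiAbsTopIII2015, Proposition 2.5 (a) p.56] -/
theorem exists_isStrictChain_three_not_strictlyCollinear :
    ∃ L₁ L₂ L₃ : Set (univ : Set ℂ),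
      IsStrictChain {Q : Set (univ : Set ℂ) | Subtype.val '' Q ∈ squaresIn univ} [L₁, L₂, L₃] ∧
      IsLineSegment {Q : Set (univ : Set ℂ) | Subtype.val '' Q ∈ squaresIn univ} (L₁ ∪ L₂ ∪ L₃) ∧
      ¬ StrictlyCollinear L₁ L₃ := by
  obtain ⟨L₁, L₂, L₃, h₁, h₂, h₃, h₁₂, h₂₃, h₁₃⟩ := exists_strictLineSegments_strictlyCollinear_not_trans
  have hc : IsStrictChain {Q : Set (univ : Set ℂ) | Subtype.val '' Q ∈ squaresIn univ} [L₁, L₂, L₃] :=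
    ⟨by simp, by simpa using ⟨h₁, h₂, h₃⟩,
      List.IsChain.cons_cons h₁₂ (List.IsChain.cons_cons h₂₃ (List.isChain_singleton _))⟩
  refine ⟨L₁, L₂, L₃, hc, ⟨[L₁, L₂, L₃], hc, ?_⟩, h₁₃⟩
  simp [union_assoc]

end Transitivity

end Parallelograms

end

end Literature.AnabelianGeometry.AbsoluteAnabelian
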